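import Summits.CriticalPhenomena.PercolationContinuityZ3.Theorems.PercNearOneGluingAdditiveGluingKnLemma2General
import Summits.CriticalPhenomena.PercolationContinuityZ3.Theorems.PercNearOneGluingNoHeavyLowerTailSmallBlockTransfer
import HarnessLib

/-!
# `NoHeavyLowerTail` (stmt-CriticalPhenomena-4575) — singleton-pocket packing, AUXILIARY steps

Support file (coupling seat `prim-cplus-coupling`, gen 2; `--supports stmt-CriticalPhenomena-4575`).  No definitions,
no named facts, no sorries.  Bond percolation `μ = prodBernoulli w` on `Fin n`, relays `A`, level `j`,
`π(v) = A.filter (fun z => ω ∈ openConn v z)`.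

The van den Berg–Häggström–Kahn steps (set sources, via the landed `stub_bhkSets`) and the set bookkeeping used by
`…SingletonPocketPacking.lean` (theorem `singletonPocket_le_heavy`: for a champion `c`,
`μ(|π(o)| = 1, |π(c)| > j) ≤ μ(|π(o)| > j, o ↮ c)`):

* `monotone_heavy` / `heavy_apply`, `monotone_allPairs` / `allPairs_apply` — the increasing functionals
  `1{c heavy}` of `C_{S'}` (`c ∈ S'`) and `1{T internally connected}` of `C_T`;
* `isolated_conn_heavy` — BHK Thm 1.4 for the sources `{t}`, `A ∖ t`:
  `μ(D) μ(D ∩ {t↔o} ∩ {c heavy}) ≤ μ(D ∩ {t↔o}) μ(D ∩ {c heavy})`, `D = {t isolated}`;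
* `block_conn` — BHK Thm 1.3 for the source set `T`: `μ(D ∩ {T↔o}) μ(D ∩ {T int. conn.}) ≤ μ(D) μ(D ∩ both)`;
* `lonely_subset`, `heavy_transfer` (the champion hypothesis: `μ(t↮c, c heavy) ≤ μ(t↮c, t heavy)`),
  `heavy_subset_blocks`, `block_eq`, `blockConn_subset`, `blockConn_disjoint`.
[cite: VandenbergHaggstromKahn2005, Thms. 1.3–1.4 (pp. 6–7); KozmaNitzan2024, §2.2]
-/

noncomputable section

namespace Summit.CriticalPhenomena.PercolationContinuityZ3.Theorems

open MeasureTheory Set Literature.Probability.LatticeModels Literature.Probability.Percolation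
open scoped Classical BigOperators

namespace SingletonPocketPacking

section General

variable {V : Type*}

/-- The indicator of the up-set `{C | all vertices of T are pairwise joined in C}` is increasing. [folklore] -/
theorem monotone_allPairs (T : Finset V) :
    Monotone ({C : Set (Sym2 V) | ∀ s ∈ T, ∀ s' ∈ T, (openGraph C).Reachable s s'}.indicator
      (1 : Set (Sym2 V) → ℝ)) := by
  intro C C' hCC'
  by_cases h : C ∈ {C : Set (Sym2 V) | ∀ s ∈ T, ∀ s' ∈ T, (openGraph C).Reachable s s'}
  · have h' : C' ∈ {C : Set (Sym2 V) | ∀ s ∈ T, ∀ s' ∈ T, (openGraph C).Reachable s s'} :=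
      fun s hs s' hs' => (h s hs s' hs').mono (openGraph_mono hCC')
    rw [Set.indicator_of_mem h, Set.indicator_of_mem h', Pi.one_apply, Pi.one_apply]
  · rw [Set.indicator_of_notMem h]
    exact Set.indicator_nonneg (fun _ _ => zero_le_one) _

/-- At `C = C_T(ω)`, the all-pairs indicator is `1{T internally connected}(ω)`. [folklore] -/
theorem allPairs_apply (T : Finset V) (ω : BondConfig V) :
    {C : Set (Sym2 V) | ∀ s ∈ T, ∀ s' ∈ T, (openGraph C).Reachable s s'}.indicator (1 : Set (Sym2 V) → ℝ)
        (⋃ s ∈ T, openEdgeCluster ω s) =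
      {ω : BondConfig V | ∀ s ∈ T, ∀ s' ∈ T, ω ∈ openConn s s'}.indicator 1 ω := by
  by_cases h : ∀ s ∈ T, ∀ s' ∈ T, (openGraph ω).Reachable s s'
  · have h1 : (⋃ s ∈ T, openEdgeCluster ω s) ∈
        {C : Set (Sym2 V) | ∀ s ∈ T, ∀ s' ∈ T, (openGraph C).Reachable s s'} :=
      fun s hs s' hs' => (knThm2_reachable_biUnion_iff T hs s' ω).2 (h s hs s' hs')
    have h2 : ω ∈ {ω : BondConfig V | ∀ s ∈ T, ∀ s' ∈ T, ω ∈ openConn s s'} := h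
    rw [Set.indicator_of_mem h1, Set.indicator_of_mem h2, Pi.one_apply, Pi.one_apply]
  · have h1 : (⋃ s ∈ T, openEdgeCluster ω s) ∉
        {C : Set (Sym2 V) | ∀ s ∈ T, ∀ s' ∈ T, (openGraph C).Reachable s s'} :=
      fun h1 => h fun s hs s' hs' => (knThm2_reachable_biUnion_iff T hs s' ω).1 (h1 s hs s' hs')
    have h2 : ω ∉ {ω : BondConfig V | ∀ s ∈ T, ∀ s' ∈ T, ω ∈ openConn s s'} := h
    rw [Set.indicator_of_notMem h1, Set.indicator_of_notMem h2]

end General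

variable {n : ℕ}

/-- The indicator of the up-set `{C | j < |{z ∈ A : c ↔ z in C}|}` ("`c` is heavy in `C`") is increasing. [folklore] -/
theorem monotone_heavy (A : Finset (Fin n)) (c : Fin n) (j : ℕ) :
    Monotone ({C : Set (Sym2 (Fin n)) | j < (A.filter fun z => (openGraph C).Reachable c z).card}.indicator
      (1 : Set (Sym2 (Fin n)) → ℝ)) := by
  intro C C' hCC'
  by_cases h : C ∈ {C : Set (Sym2 (Fin n)) | j < (A.filter fun z => (openGraph C).Reachable c z).card}
  · have h' : C' ∈ {C : Set (Sym2 (Fin n)) | j < (A.filter fun z => (openGraph C).Reachable c z).card} := by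
      refine lt_of_lt_of_le (α := ℕ) h (Finset.card_le_card ?_)
      intro z hz
      rw [Finset.mem_filter] at hz ⊢
      exact ⟨hz.1, hz.2.mono (openGraph_mono hCC')⟩
    rw [Set.indicator_of_mem h, Set.indicator_of_mem h', Pi.one_apply, Pi.one_apply]
  · rw [Set.indicator_of_notMem h]
    exact Set.indicator_nonneg (fun _ _ => zero_le_one) _

/-- At `C = C_{S'}(ω)` with `c ∈ S'`, the heaviness indicator of `c` is `1{j < |π(c)|}(ω)`. [folklore] -/
theorem heavy_apply (S' A : Finset (Fin n)) {c : Fin n} (hc : c ∈ S') (j : ℕ) (ω : BondConfig (Fin n)) :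
    {C : Set (Sym2 (Fin n)) | j < (A.filter fun z => (openGraph C).Reachable c z).card}.indicator (1 : Set (Sym2 (Fin n)) → ℝ)
        (⋃ s' ∈ S', openEdgeCluster ω s') =
      {ω : BondConfig (Fin n) | j < (A.filter fun z => ω ∈ openConn c z).card}.indicator 1 ω := by
  have hfil : (A.filter fun z => (openGraph (⋃ s' ∈ S', openEdgeCluster ω s')).Reachable c z) =
      (A.filter fun z => ω ∈ openConn c z) :=
    Finset.filter_congr fun z _ => knThm2_reachable_biUnion_iff S' hc z ω
  by_cases h : j < (A.filter fun z => ω ∈ openConn c z).card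
  · have h1 : (⋃ s' ∈ S', openEdgeCluster ω s') ∈
        {C : Set (Sym2 (Fin n)) | j < (A.filter fun z => (openGraph C).Reachable c z).card} := by
      show j < _; rw [hfil]; exact h
    have h2 : ω ∈ {ω : BondConfig (Fin n) | j < (A.filter fun z => ω ∈ openConn c z).card} := h
    rw [Set.indicator_of_mem h1, Set.indicator_of_mem h2, Pi.one_apply, Pi.one_apply]
  · have h1 : (⋃ s' ∈ S', openEdgeCluster ω s') ∉
        {C : Set (Sym2 (Fin n)) | j < (A.filter fun z => (openGraph C).Reachable c z).card} := by
      intro h1; apply h; have h1' : j < _ := h1; rwa [hfil] at h1'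
    have h2 : ω ∉ {ω : BondConfig (Fin n) | j < (A.filter fun z => ω ∈ openConn c z).card} := h
    rw [Set.indicator_of_notMem h1, Set.indicator_of_notMem h2]


/-- **Step 1: BHK Thm 1.4 for the sources `{t}`, `A ∖ t`** with `f = 1{t ↔ o}`, `g = 1{c heavy}` (`c ∈ A ∖ t`):
`μ(D) · μ(D ∩ {t ↔ o} ∩ {c heavy}) ≤ μ(D ∩ {t ↔ o}) · μ(D ∩ {c heavy})`, `D = {t isolated from A ∖ t}`.
[cite: VandenbergHaggstromKahn2005, Thm. 1.4 (p. 7)] -/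
theorem isolated_conn_heavy (w : Sym2 (Fin n) → unitInterval) (A : Finset (Fin n)) (t o c : Fin n) (j : ℕ)
    (hc : c ∈ A.erase t) :
    (prodBernoulli w).real {ω : BondConfig (Fin n) | ∀ s ∈ ({t} : Finset (Fin n)), ∀ x ∈ A.erase t,
        ¬ (openGraph ω).Reachable s x} *
      (prodBernoulli w).real ({ω : BondConfig (Fin n) | ∀ s ∈ ({t} : Finset (Fin n)), ∀ x ∈ A.erase t,
        ¬ (openGraph ω).Reachable s x} ∩ ((⋃ s ∈ ({t} : Finset (Fin n)), openConn s o) ∩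
          {ω : BondConfig (Fin n) | j < (A.filter fun z => ω ∈ openConn c z).card})) ≤
    (prodBernoulli w).real ({ω : BondConfig (Fin n) | ∀ s ∈ ({t} : Finset (Fin n)), ∀ x ∈ A.erase t,
        ¬ (openGraph ω).Reachable s x} ∩ ⋃ s ∈ ({t} : Finset (Fin n)), openConn s o) *
      (prodBernoulli w).real ({ω : BondConfig (Fin n) | ∀ s ∈ ({t} : Finset (Fin n)), ∀ x ∈ A.erase t,
        ¬ (openGraph ω).Reachable s x} ∩ {ω : BondConfig (Fin n) | j < (A.filter fun z => ω ∈ openConn c z).card}) := by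
  have hdisj : Disjoint ({t} : Finset (Fin n)) (A.erase t) := by
    rw [Finset.disjoint_singleton_left]; exact Finset.notMem_erase t A
  have key := stub_bhkSets.2 n w {t} (A.erase t)
    ({C : Set (Sym2 (Fin n)) | ∃ s ∈ ({t} : Finset (Fin n)), (openGraph C).Reachable s o}.indicator 1)
    ({C : Set (Sym2 (Fin n)) | j < (A.filter fun z => (openGraph C).Reachable c z).card}.indicator 1)
    (knThm2_monotone_anyReach {t} o) (monotone_heavy A c j) hdisj
  simp only [knThm2_anyReach_apply, heavy_apply (A.erase t) A hc] at key
  set D : Set (BondConfig (Fin n)) :=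
    {ω : BondConfig (Fin n) | ∀ s ∈ ({t} : Finset (Fin n)), ∀ x ∈ A.erase t, ¬ (openGraph ω).Reachable s x} with hD
  have h := knThm2_setIntegral_indicator w D (⋃ s ∈ ({t} : Finset (Fin n)), openConn s o)
    {ω : BondConfig (Fin n) | j < (A.filter fun z => ω ∈ openConn c z).card}
  have h' := knThm2_setIntegral_indicator w D
    {ω : BondConfig (Fin n) | j < (A.filter fun z => ω ∈ openConn c z).card}
    {ω : BondConfig (Fin n) | j < (A.filter fun z => ω ∈ openConn c z).card}
  rw [h.1, h'.1, h.2] at key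
  exact key

/-- **Step 3b: BHK Thm 1.3 for the source set `T` against `A ∖ T`** with `f = 1{T ↔ o}`, `g = 1{T internally connected}`:
`μ(D ∩ {T ↔ o}) · μ(D ∩ {T int. connected}) ≤ μ(D) · μ(D ∩ {T ↔ o} ∩ {T int. connected})`, `D = {T ↮ A ∖ T}`.
[cite: VandenbergHaggstromKahn2005, Thm. 1.3 (p. 6)] -/
theorem block_conn (w : Sym2 (Fin n) → unitInterval) (A T : Finset (Fin n)) (o : Fin n) :
    (prodBernoulli w).real ({ω : BondConfig (Fin n) | ∀ s ∈ T, ∀ x ∈ (↑(A \ T) : Set (Fin n)),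
        ¬ (openGraph ω).Reachable s x} ∩ ⋃ s ∈ T, openConn s o) *
      (prodBernoulli w).real ({ω : BondConfig (Fin n) | ∀ s ∈ T, ∀ x ∈ (↑(A \ T) : Set (Fin n)),
        ¬ (openGraph ω).Reachable s x} ∩ {ω : BondConfig (Fin n) | ∀ s ∈ T, ∀ s' ∈ T, ω ∈ openConn s s'}) ≤
    (prodBernoulli w).real {ω : BondConfig (Fin n) | ∀ s ∈ T, ∀ x ∈ (↑(A \ T) : Set (Fin n)),
        ¬ (openGraph ω).Reachable s x} *
      (prodBernoulli w).real ({ω : BondConfig (Fin n) | ∀ s ∈ T, ∀ x ∈ (↑(A \ T) : Set (Fin n)),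
        ¬ (openGraph ω).Reachable s x} ∩ ((⋃ s ∈ T, openConn s o) ∩
          {ω : BondConfig (Fin n) | ∀ s ∈ T, ∀ s' ∈ T, ω ∈ openConn s s'})) := by
  have hTX : ∀ s ∈ T, s ∉ (↑(A \ T) : Set (Fin n)) := fun s hs h => by
    rw [Finset.mem_coe, Finset.mem_sdiff] at h; exact h.2 hs
  have key := stub_bhkSets.1 n w T (↑(A \ T) : Set (Fin n))
    ({C : Set (Sym2 (Fin n)) | ∃ s ∈ T, (openGraph C).Reachable s o}.indicator 1)
    ({C : Set (Sym2 (Fin n)) | ∀ s ∈ T, ∀ s' ∈ T, (openGraph C).Reachable s s'}.indicator 1)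
    (knThm2_monotone_anyReach T o) (monotone_allPairs T) hTX
  simp only [knThm2_anyReach_apply, allPairs_apply T] at key
  set D : Set (BondConfig (Fin n)) :=
    {ω : BondConfig (Fin n) | ∀ s ∈ T, ∀ x ∈ (↑(A \ T) : Set (Fin n)), ¬ (openGraph ω).Reachable s x} with hD
  have h := knThm2_setIntegral_indicator w D (⋃ s ∈ T, openConn s o)
    {ω : BondConfig (Fin n) | ∀ s ∈ T, ∀ s' ∈ T, ω ∈ openConn s s'}
  have h' := knThm2_setIntegral_indicator w D
    {ω : BondConfig (Fin n) | ∀ s ∈ T, ∀ s' ∈ T, ω ∈ openConn s s'}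
    {ω : BondConfig (Fin n) | ∀ s ∈ T, ∀ s' ∈ T, ω ∈ openConn s s'}
  rw [h.1, h'.1, h.2] at key
  exact key


/-! ### Set-theoretic bookkeeping -/

/-- **Step 0.** `{N = 1, c heavy} ⊆ ⋃_{t ∈ A ∖ c} {t isolated} ∩ {t ↔ o} ∩ {c heavy}` (`j ≥ 1`). [folklore] -/
theorem lonely_subset (A : Finset (Fin n)) (o c : Fin n) {j : ℕ} (hj : 1 ≤ j) :
    {ω : BondConfig (Fin n) | (A.filter fun z => ω ∈ openConn o z).card = 1 ∧
        j < (A.filter fun z => ω ∈ openConn c z).card} ⊆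
      ⋃ t ∈ A.erase c, ({ω : BondConfig (Fin n) | ∀ s ∈ ({t} : Finset (Fin n)), ∀ x ∈ A.erase t,
          ¬ (openGraph ω).Reachable s x} ∩ ((⋃ s ∈ ({t} : Finset (Fin n)), (openConn s o : Set (BondConfig (Fin n)))) ∩
          {ω : BondConfig (Fin n) | j < (A.filter fun z => ω ∈ openConn c z).card})) := by
  intro ω hω
  obtain ⟨h1, hc⟩ := hω
  obtain ⟨t, ht⟩ := Finset.card_eq_one.1 h1
  have htmem : t ∈ A.filter fun z => ω ∈ openConn o z := by rw [ht]; exact Finset.mem_singleton_self t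
  rw [Finset.mem_filter] at htmem
  have hot : (openGraph ω).Reachable o t := htmem.2
  have htc : t ≠ c := by
    intro htc
    subst htc
    have := SmallBlockTransfer.filter_eq_of_reachable A hot
    rw [← this, h1] at hc
    omega
  simp only [Set.mem_iUnion, Set.mem_inter_iff, Set.mem_setOf_eq, exists_prop]
  refine ⟨t, Finset.mem_erase.2 ⟨htc, htmem.1⟩, ?_, ?_, hc⟩
  · intro s hs x hx
    rw [Finset.mem_singleton] at hs
    subst hs
    intro hsx
    have hx' : x ∈ A.filter fun z => ω ∈ openConn o z :=
      Finset.mem_filter.2 ⟨(Finset.mem_erase.1 hx).2, (hot.trans hsx : (openGraph ω).Reachable o x)⟩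
    rw [ht, Finset.mem_singleton] at hx'
    exact (Finset.mem_erase.1 hx).1 hx'
  · exact ⟨t, Finset.mem_singleton_self t, (hot.symm : (openGraph ω).Reachable t o)⟩

/-- **Step 2 (the champion hypothesis).**  If `μ(|π(t)| ≤ j) ≤ μ(|π(c)| ≤ j)` then
`μ(t ↮ c, |π(c)| > j) ≤ μ(t ↮ c, |π(t)| > j)`: the two lightness events agree on `{t ↔ c}`. [folklore] -/
theorem heavy_transfer (w : Sym2 (Fin n) → unitInterval) (A : Finset (Fin n)) (t c : Fin n) (j : ℕ)
    (hle : (prodBernoulli w).real {ω : BondConfig (Fin n) | (A.filter fun z => ω ∈ openConn t z).card ≤ j} ≤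
      (prodBernoulli w).real {ω : BondConfig (Fin n) | (A.filter fun z => ω ∈ openConn c z).card ≤ j}) :
    (prodBernoulli w).real ((openConn t c : Set (BondConfig (Fin n)))ᶜ ∩
        {ω : BondConfig (Fin n) | j < (A.filter fun z => ω ∈ openConn c z).card}) ≤
      (prodBernoulli w).real ((openConn t c : Set (BondConfig (Fin n)))ᶜ ∩
        {ω : BondConfig (Fin n) | j < (A.filter fun z => ω ∈ openConn t z).card}) := by
  set μ := prodBernoulli w with hμ
  set C : Set (BondConfig (Fin n)) := openConn t c with hC
  set Lt : Set (BondConfig (Fin n)) := {ω | (A.filter fun z => ω ∈ openConn t z).card ≤ j} with hLt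
  set Lc : Set (BondConfig (Fin n)) := {ω | (A.filter fun z => ω ∈ openConn c z).card ≤ j} with hLc
  have hmeas : ∀ S : Set (BondConfig (Fin n)), MeasurableSet S := fun S => (Set.toFinite S).measurableSet
  have hLC : Lt ∩ C = Lc ∩ C := by
    ext ω
    simp only [hLt, hLc, hC, Set.mem_inter_iff, Set.mem_setOf_eq]
    constructor
    · rintro ⟨h, htc⟩
      exact ⟨by rwa [← SmallBlockTransfer.filter_eq_of_reachable A (htc : (openGraph ω).Reachable t c)], htc⟩
    · rintro ⟨h, htc⟩
      exact ⟨by rwa [SmallBlockTransfer.filter_eq_of_reachable A (htc : (openGraph ω).Reachable t c)], htc⟩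
  have h1 : μ.real (Lt ∩ C) + μ.real (Lt \ C) = μ.real Lt := measureReal_inter_add_sdiff (hmeas C)
  have h2 : μ.real (Lc ∩ C) + μ.real (Lc \ C) = μ.real Lc := measureReal_inter_add_sdiff (hmeas C)
  have h3 : μ.real (Cᶜ ∩ Lt) + μ.real (Cᶜ \ Lt) = μ.real Cᶜ := measureReal_inter_add_sdiff (hmeas Lt)
  have h4 : μ.real (Cᶜ ∩ Lc) + μ.real (Cᶜ \ Lc) = μ.real Cᶜ := measureReal_inter_add_sdiff (hmeas Lc)
  have e1 : Cᶜ ∩ Lt = Lt \ C := by ext ω; simp only [Set.mem_inter_iff, Set.mem_compl_iff, Set.mem_sdiff]; tauto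
  have e2 : Cᶜ ∩ Lc = Lc \ C := by ext ω; simp only [Set.mem_inter_iff, Set.mem_compl_iff, Set.mem_sdiff]; tauto
  have e3 : Cᶜ ∩ {ω : BondConfig (Fin n) | j < (A.filter fun z => ω ∈ openConn c z).card} = Cᶜ \ Lc := by
    ext ω; simp only [hLc, Set.mem_inter_iff, Set.mem_compl_iff, Set.mem_sdiff, Set.mem_setOf_eq, not_le]
  have e4 : Cᶜ ∩ {ω : BondConfig (Fin n) | j < (A.filter fun z => ω ∈ openConn t z).card} = Cᶜ \ Lt := by
    ext ω; simp only [hLt, Set.mem_inter_iff, Set.mem_compl_iff, Set.mem_sdiff, Set.mem_setOf_eq, not_le]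
  rw [e3, e4]
  rw [e1] at h3
  rw [e2] at h4
  rw [hLC] at h1
  linarith

/-- **Step 2b.**  `{t ↮ c, |π(t)| > j} ⊆ ⋃ {T is a block}` over the heavy `T ⊆ A ∖ c` containing `t` (`t ∈ A`). [folklore] -/
theorem heavy_subset_blocks (A : Finset (Fin n)) {t : Fin n} (ht : t ∈ A) (c : Fin n) (j : ℕ) :
    (openConn t c : Set (BondConfig (Fin n)))ᶜ ∩ {ω : BondConfig (Fin n) | j < (A.filter fun z => ω ∈ openConn t z).card} ⊆
      ⋃ T ∈ ((A.erase c).powerset.filter fun T => j < T.card).filter (fun T => t ∈ T),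
        {ω : BondConfig (Fin n) | ∀ s ∈ T, (A.filter fun z => ω ∈ openConn s z) = T} := by
  intro ω hω
  obtain ⟨hntc, hHt⟩ := hω
  simp only [Set.mem_iUnion, Set.mem_setOf_eq, exists_prop]
  refine ⟨A.filter fun z => ω ∈ openConn t z, ?_, ?_⟩
  · rw [Finset.mem_filter, Finset.mem_filter, Finset.mem_powerset]
    refine ⟨⟨fun z hz => ?_, hHt⟩, Finset.mem_filter.2 ⟨ht, (SimpleGraph.Reachable.refl t : (openGraph ω).Reachable t t)⟩⟩
    rw [Finset.mem_filter] at hz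
    refine Finset.mem_erase.2 ⟨?_, hz.1⟩
    rintro rfl
    exact hntc hz.2
  · intro s hs
    rw [Finset.mem_filter] at hs
    exact (SmallBlockTransfer.filter_eq_of_reachable A (hs.2 : (openGraph ω).Reachable t s)).symm

/-- A block `T ⊆ A` is exactly: `T` separated from `A ∖ T` and internally connected. [folklore] -/
theorem block_eq (A T : Finset (Fin n)) (hTA : T ⊆ A) :
    {ω : BondConfig (Fin n) | ∀ s ∈ T, (A.filter fun z => ω ∈ openConn s z) = T} =
      {ω : BondConfig (Fin n) | ∀ s ∈ T, ∀ x ∈ (↑(A \ T) : Set (Fin n)), ¬ (openGraph ω).Reachable s x} ∩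
        {ω : BondConfig (Fin n) | ∀ s ∈ T, ∀ s' ∈ T, ω ∈ openConn s s'} := by
  ext ω
  simp only [Set.mem_setOf_eq, Set.mem_inter_iff, Finset.coe_sdiff, Set.mem_sdiff, Finset.mem_coe]
  constructor
  · intro h
    refine ⟨fun s hs x hx hsx => hx.2 ?_, fun s hs s' hs' => ?_⟩
    · rw [← h s hs]; exact Finset.mem_filter.2 ⟨hx.1, hsx⟩
    · have := h s hs
      have hs'T : s' ∈ A.filter fun z => ω ∈ openConn s z := by rw [this]; exact hs'
      exact (Finset.mem_filter.1 hs'T).2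
  · rintro ⟨hD, hI⟩ s hs
    ext z
    rw [Finset.mem_filter]
    constructor
    · rintro ⟨hzA, hsz⟩
      by_contra hzT
      exact hD s hs z ⟨hzA, hzT⟩ hsz
    · intro hz
      exact ⟨hTA hz, hI s hs z hz⟩

/-- **Step 4.**  For a heavy `T ⊆ A ∖ c` (`c ∈ A`): `{T is a block} ∩ {T ↔ o} ⊆ {N > j, o ↮ c}`. [folklore] -/
theorem blockConn_subset (A : Finset (Fin n)) (o : Fin n) {c : Fin n} (hcA : c ∈ A) (j : ℕ) {T : Finset (Fin n)}
    (hT : T ∈ (A.erase c).powerset.filter fun T => j < T.card) :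
    {ω : BondConfig (Fin n) | ∀ s ∈ T, (A.filter fun z => ω ∈ openConn s z) = T} ∩
        (⋃ s ∈ T, (openConn s o : Set (BondConfig (Fin n)))) ⊆
      {ω : BondConfig (Fin n) | j < (A.filter fun z => ω ∈ openConn o z).card ∧ ω ∉ openConn o c} := by
  intro ω hω
  obtain ⟨hblk, hconn⟩ := hω
  simp only [Set.mem_iUnion, exists_prop] at hconn
  obtain ⟨s, hs, hso⟩ := hconn
  rw [Finset.mem_filter, Finset.mem_powerset] at hT
  have hso' : (openGraph ω).Reachable s o := hso
  have hfil : (A.filter fun z => ω ∈ openConn o z) = T := by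
    rw [SmallBlockTransfer.filter_eq_of_reachable A hso'.symm]; exact hblk s hs
  refine ⟨by rw [hfil]; exact hT.2, fun hoc => ?_⟩
  have hc : c ∈ A.filter fun z => ω ∈ openConn o z := Finset.mem_filter.2 ⟨hcA, hoc⟩
  rw [hfil] at hc
  exact Finset.notMem_erase c A (hT.1 hc)

/-- **Step 4b.**  The events `{T is a block} ∩ {T ↔ o}` for distinct nonempty `T` are disjoint. [folklore] -/
theorem blockConn_disjoint (A : Finset (Fin n)) (o : Fin n) (𝒯 : Finset (Finset (Fin n))) :
    (↑𝒯 : Set (Finset (Fin n))).PairwiseDisjoint (fun T =>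
      {ω : BondConfig (Fin n) | ∀ s ∈ T, (A.filter fun z => ω ∈ openConn s z) = T} ∩
        (⋃ s ∈ T, (openConn s o : Set (BondConfig (Fin n))))) := by
  intro T hT T' hT' hne
  refine Set.disjoint_left.2 fun ω h1 h2 => hne ?_
  obtain ⟨hb1, hc1⟩ := h1
  obtain ⟨hb2, hc2⟩ := h2
  simp only [Set.mem_iUnion, exists_prop] at hc1 hc2
  obtain ⟨s, hs, hso⟩ := hc1
  obtain ⟨s', hs', hs'o⟩ := hc2
  have hss' : (openGraph ω).Reachable s s' :=
    (hso : (openGraph ω).Reachable s o).trans (hs'o : (openGraph ω).Reachable s' o).symm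
  rw [← hb1 s hs, ← hb2 s' hs']
  exact SmallBlockTransfer.filter_eq_of_reachable A hss'

end SingletonPocketPacking

end Summit.CriticalPhenomena.PercolationContinuityZ3.Theorems
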